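import Literature.NumberTheory.GelbartRogawski1991.FiniteAdelicSplittingAssembly
import Literature.NumberTheory.GelbartRogawski1991.RationalSymplecticUnramifiedVector
import Literature.NumberTheory.GelbartRogawski1991.FiniteAdelicRationalImplementer
import Literature.NumberTheory.GelbartRogawski1991.DoubledUnitarySiegelPlaceComponents
import Literature.NumberTheory.GelbartRogawski1991.DoubledUnitarySiegelParabolicAlgebra
import HarnessLib

-- buildfix G11b-3 recipe (LEDGER B13-1/B13-3): elaborate sequentially so the trailing `attribute [implicit_reducible]`
-- block (reducibilityCoreExt is keyed to the async environment branch) is in force at `.olean` export.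
set_option Elab.async false

/-!
# The finite half of the doubled Weil representation from the per-place package

[GelbartRogawski1991, §3.1 Prop. 3.1.1] by doubling, finite places: from a `FinLocalFamily χ 𝔪` of
`DoubledUnitaryGlobalSplittingData` (at every finite place `v` of `L⁺` a Lagrangian, a `LocalSplittingDatum` at the
doubled data, the local parabolic normalisation `ParabolicNormalisedAt v`, and the unramified clause for almost all
`v`) the restricted tensor product `s_f := ⊗'_v s_v : H(𝔸_f) →* Mp(𝕎^𝔻)ᶜᵒⁿᵗ` of the tree's
`FiniteAdelicSplittingAssembly.finSplitting` is a FINITE HALF: `IsFinHalf χ s_f` (`finHalf_isFinHalf`, `S1fin_asm`).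
The parabolic prescription on `P_Δ(𝔸_f)` is transferred from the local prescriptions by the tree's origin-value
transfer `FiniteAdelicRationalImplementer.conjOp_apply_zero` [Weil1964, n° 37–40], applied to the implementers
`c_v⁻¹ r_v(δ_v)` of the rational element `δ` normalised to fix `1_{𝒪_vᴺ}` almost everywhere
(`RationalSymplecticUnramifiedVector.eventually_exists_smul_unitVec`), with the continuity of
`g ↦ χ(det_Δ g)|det_Δ g|^{1/2}` on the Siegel set of `H(𝔸_f)` (§(a)) and the placewise description of that set (§(b),
`DoubledUnitarySiegelPlaceComponents`).
-/

set_option autoImplicit false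

noncomputable section

open scoped Classical
open scoped Matrix Kronecker TensorProduct
open NumberField IsDedekindDomain
open Literature.RepresentationTheory.HeisenbergGroup
open Literature.NumberTheory.Automorphic
open Literature.NumberTheory.Weil1964
open Literature.RepresentationTheory.HarrisKudlaSweet1996
open Literature.NumberTheory.GaloisRepresentations

namespace Literature.NumberTheory.GelbartRogawski1991.GRConstruction

open UnitaryDualPair

variable (L : Type) [Field L] [NumberField L] [IsCMField L]

variable {N M n : ℕ} (e : Fin N × Fin M ≃ Fin n)
  (dV : Fin N → L) (hdV : ∀ i, IsCMField.complexConj L (dV i) = dV i) (hdV0 : ∀ i, dV i ≠ 0)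
  (dW : Fin M → L) (hdW : ∀ i, IsCMField.complexConj L (dW i) = dW i) (hdW0 : ∀ i, dW i ≠ 0)

section S1finAsm

open Literature.NumberTheory.GelbartRogawski1991.UnitaryDualPair.LocalSplitting MeasureTheory

local notation "LocPi'" => UnitaryGroup.localPi L (IsCMField.complexConj L) (n + n) (hermD L e dV hdV dW hdW)
local notation "HAf'" => UnitaryGroup.finAdelic (Fp L) L (IsCMField.complexConj L) (n + n) (hermD L e dV hdV dW hdW)
local notation "finToA'" => UnitaryGroup.finAdelicToAdelic (Fp L) L (IsCMField.complexConj L) (n + n) (hermD L e dV hdV dW hdW)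
local notation "inclP'" => UnitaryGroup.inclPlace (Fp L) L (IsCMField.complexConj L) (n + n) (hermD L e dV hdV dW hdW)
local notation "evalP'" => UnitaryGroup.evalPlace (Fp L) L (IsCMField.complexConj L) (n + n) (hermD L e dV hdV dW hdW)

/-! ##### (a) continuity of `det_Δ` and of the prescribed scalar on the Siegel set of `H(𝔸_f)` -/

/-- `h ↦ det_Δ h` is continuous on `H(𝔸)` (a polynomial in the matrix entries).
[cite: GelbartRogawski1991, §3.1 Prop. 3.1.1 p. 455 L1–2] -/
theorem continuous_detDelta : Continuous (detDelta L e dV hdV dW hdW) := by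
  have hval : Continuous fun h : HA L e dV hdV dW hdW =>
      ((h : GL (Fin (n + n)) (AdeleRing (𝓞 L) L)) : Matrix (Fin (n + n)) (Fin (n + n)) (AdeleRing (𝓞 L) L)) :=
    Units.continuous_val.comp continuous_subtype_val
  have hblk : Continuous (blk L e dV hdV dW hdW) :=
    continuous_matrix fun i j => hval.matrix_elem ((e₂ (n := n)) i) ((e₂ (n := n)) j)
  unfold detDelta deltaBlock
  refine Continuous.matrix_det (Continuous.add ?_ ?_)
  · exact continuous_matrix fun i j => hblk.matrix_elem _ _
  · exact continuous_matrix fun i j => hblk.matrix_elem _ _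

/-- the Siegel set `{g ∈ H(𝔸_f) | (1, g) ∈ P_Δ(𝔸)}`. [cite: GelbartRogawski1991, §3.1 Prop. 3.1.1 p. 455 L1–2] -/
def siegelSetFin : Set HAf' := {g | IsSiegelDelta L e dV hdV dW hdW (finToA' g)}

/-- membership. [cite: GelbartRogawski1991, §3.1 Prop. 3.1.1 p. 455 L1–2] -/
theorem mem_siegelSetFin_iff (g : HAf') :
    g ∈ siegelSetFin L e dV hdV dW hdW ↔ IsSiegelDelta L e dV hdV dW hdW (finToA' g) := Iff.rfl

/-- the unit `det_Δ(finToA g)` for `g` in the Siegel set, as a CONTINUOUS map into the ideles.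
[cite: GelbartRogawski1991, §3.1 Prop. 3.1.1 p. 455 L1–2] -/
theorem continuousOn_unit_detDelta (U : HAf' → ideleGroup L)
    (hU : ∀ g, IsSiegelDelta L e dV hdV dW hdW (finToA' g) → (U g : AdeleRing (𝓞 L) L) = detDelta L e dV hdV dW hdW (finToA' g)) :
    ContinuousOn U (siegelSetFin L e dV hdV dW hdW) := by
  rw [continuousOn_iff_continuous_restrict]
  refine Units.continuous_iff.2 ⟨?_, ?_⟩
  · have h : (fun g : siegelSetFin L e dV hdV dW hdW => ((U (g : HAf') : ideleGroup L) : AdeleRing (𝓞 L) L)) =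
        fun g : siegelSetFin L e dV hdV dW hdW => detDelta L e dV hdV dW hdW (finToA' (g : HAf')) := funext fun g => hU (g : HAf') g.2
    change Continuous fun g : siegelSetFin L e dV hdV dW hdW => ((U (g : HAf') : ideleGroup L) : AdeleRing (𝓞 L) L)
    rw [h]
    exact (continuous_detDelta L e dV hdV dW hdW).comp
      ((UnitaryGroup.continuous_finAdelicToAdelic (Fp L) L (IsCMField.complexConj L) (n + n) (hermD L e dV hdV dW hdW)).comp
        continuous_subtype_val)
  · have h : (fun g : siegelSetFin L e dV hdV dW hdW => ((U (g : HAf'))⁻¹ : ideleGroup L).val) =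
        fun g : siegelSetFin L e dV hdV dW hdW => detDelta L e dV hdV dW hdW (finToA' (g : HAf')⁻¹) := funext fun g => by
      have e1 : ((U (g : HAf'))⁻¹ : ideleGroup L).val * detDelta L e dV hdV dW hdW (finToA' (g : HAf')) = 1 := by
        rw [← hU (g : HAf') g.2, Units.inv_mul]
      have e2 : detDelta L e dV hdV dW hdW (finToA' (g : HAf')) * detDelta L e dV hdV dW hdW (finToA' (g : HAf')⁻¹) = 1 := by
        rw [map_inv]; exact detDelta_mul_inv L e dV hdV dW hdW g.2
      calc ((U (g : HAf'))⁻¹ : ideleGroup L).val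
          = ((U (g : HAf'))⁻¹ : ideleGroup L).val * (detDelta L e dV hdV dW hdW (finToA' (g : HAf')) *
              detDelta L e dV hdV dW hdW (finToA' (g : HAf')⁻¹)) := by rw [e2, mul_one]
        _ = detDelta L e dV hdV dW hdW (finToA' (g : HAf')⁻¹) := by rw [← mul_assoc, e1, one_mul]
    change Continuous fun g : siegelSetFin L e dV hdV dW hdW => ((U (g : HAf'))⁻¹ : ideleGroup L).val
    rw [h]
    exact (continuous_detDelta L e dV hdV dW hdW).comp
      ((UnitaryGroup.continuous_finAdelicToAdelic (Fp L) L (IsCMField.complexConj L) (n + n) (hermD L e dV hdV dW hdW)).comp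
        (continuous_inv.comp continuous_subtype_val))

/-- **`g ↦ χ(det_Δ g) · |det_Δ g|^{1/2}` is continuous on the Siegel set of `H(𝔸_f)`.**
[cite: GelbartRogawski1991, §3.1 Prop. 3.1.1 p. 455 L1–2] -/
theorem continuousOn_chiDet_modDelta (χ : HeckeCharacter L) :
    ContinuousOn (fun g : HAf' => ((chiDet L e dV hdV dW hdW χ (finToA' g) : ℂˣ) : ℂ) * (modDelta L e dV hdV dW hdW (finToA' g) : ℂ))
      (siegelSetFin L e dV hdV dW hdW) := by
  -- the unit selector
  let U : HAf' → ideleGroup L := fun g =>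
    if h : IsSiegelDelta L e dV hdV dW hdW (finToA' g) then (isUnit_detDelta_of_isSiegelDelta L e dV hdV dW hdW _ h).unit else 1
  have hU : ∀ g, IsSiegelDelta L e dV hdV dW hdW (finToA' g) → (U g : AdeleRing (𝓞 L) L) = detDelta L e dV hdV dW hdW (finToA' g) :=
    fun g h => by simp only [U, dif_pos h, IsUnit.unit_spec]
  have hUc := continuousOn_unit_detDelta L e dV hdV dW hdW U hU
  have hchi : ∀ g, IsSiegelDelta L e dV hdV dW hdW (finToA' g) → chiDet L e dV hdV dW hdW χ (finToA' g) = χ (U g) := fun g h => by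
    have hu := isUnit_detDelta_of_isSiegelDelta L e dV hdV dW hdW _ h
    unfold chiDet
    rw [dif_pos hu]
    congr 1
    exact Units.ext (by rw [IsUnit.unit_spec, hU g h])
  have hmod : ∀ g, IsSiegelDelta L e dV hdV dW hdW (finToA' g) →
      modDelta L e dV hdV dW hdW (finToA' g) = Real.sqrt (ideleNorm (U g)) := fun g h => by
    have hu := isUnit_detDelta_of_isSiegelDelta L e dV hdV dW hdW _ h
    unfold modDelta
    rw [dif_pos hu]
    congr 2
    exact Units.ext (by rw [IsUnit.unit_spec, hU g h])
  have hnorm : Continuous fun x : ideleGroup L => ideleNorm x := by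
    have h := (NNReal.continuous_coe.comp (continuous_ideleNorm_holds L))
    refine h.congr fun x => ?_
    exact coe_ideleNorm L x
  refine ContinuousOn.mul ?_ ?_
  · have h1 : ContinuousOn (fun g : HAf' => ((χ (U g) : ℂˣ) : ℂ)) (siegelSetFin L e dV hdV dW hdW) :=
      (Units.continuous_val.comp (map_continuous χ)).comp_continuousOn hUc
    exact h1.congr fun g hg => by simp only [hchi g hg]
  · have h2 : ContinuousOn (fun g : HAf' => ((Real.sqrt (ideleNorm (U g)) : ℝ) : ℂ)) (siegelSetFin L e dV hdV dW hdW) :=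
      (Complex.continuous_ofReal.comp (Real.continuous_sqrt.comp hnorm)).comp_continuousOn hUc
    exact h2.congr fun g hg => by simp only [hmod g hg]

/-! ##### (b) the Siegel set of `H(𝔸_f)` place by place -/

/-- `finToA g ∈ P_Δ(𝔸) ↔ ι_v(g_v) ∈ P_Δ(𝔸)` for every finite place `v`.
[cite: GelbartRogawski1991, §3.1 Prop. 3.1.1 p. 455 L1–2] -/
theorem isSiegelDelta_finToA_iff_forall_place (g : HAf') :
    IsSiegelDelta L e dV hdV dW hdW (finToA' g) ↔ ∀ v, IsSiegelDelta L e dV hdV dW hdW (locToAdelic L e dV hdV dW hdW v (evalP' v g)) := by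
  rw [isSiegelDelta_finAdelicToAdelic_iff, isSiegelM_iff_forall_place]
  refine ⟨fun h v => (isSiegelDelta_locToAdelic_iff L e dV hdV dW hdW v _).2 fun w => ?_, fun h w => ?_⟩
  · have hw := h w.1
    rwa [UnitaryGroup.map_eval_eq_evalAt] at hw
  · have hv := (isSiegelDelta_locToAdelic_iff L e dV hdV dW hdW (w.under (𝓞 (Fp L))) _).1 (h (w.under (𝓞 (Fp L)))) ⟨w, rfl⟩
    rw [UnitaryGroup.map_eval_eq_evalAt]
    exact hv
/-! ##### (c) the family of local splittings of the per-place package, in the shape `FinLocalSplittings` -/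

section Family

variable (χ : HeckeCharacter L) (𝔪 : ∀ v, PlaceMeasure L v) (𝓕 : FinLocalFamily L e dV hdV hdV0 dW hdW hdW0 χ 𝔪)

/-- the local splitting of the family at `v` (instances unbundled from `𝔪 v`).
[cite: GelbartRogawski1991, §3.1 Prop. 3.1.1 p. 455 L1–2] -/
def localSplittingAt (v : HeightOneSpectrum (𝓞 (Fp L))) :
    LocPi' v →* LocalMp (Fp L) (n + n) (gramD L e dV hdV dW hdW) v := by
  letI := (𝔪 v).mS; haveI := (𝔪 v).isBorel; haveI := (𝔪 v).isHaar
  exact LocalSplittingDatum.localSplitting (𝓕.𝓓 v)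

include 𝓕 in
/-- implementers are unique up to scalars on every local smooth Schrödinger model (the datum's field `hU`).
[cite: GelbartRogawski1991, §3.1 Prop. 3.1.1 p. 455 L1–2] -/
theorem hU_family (v : HeightOneSpectrum (𝓞 (Fp L))) :
    ImplementerUniqueUpToScalar (localSchrodinger (Fp L) (n + n) (gramD L e dV hdV dW hdW) v) := by
  letI := (𝔪 v).mS; haveI := (𝔪 v).isBorel; haveI := (𝔪 v).isHaar
  exact (𝓕.𝓓 v).hU

/-- **the family as a `FinLocalSplittings`** (tree `FiniteAdelicSplittingAssembly`): `s v := (𝓓 v).localSplitting`, over `ι_v`, smooth, unramified a.e.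
[cite: GelbartRogawski1991, §3.1 Prop. 3.1.1 p. 455 L1–2] -/
def finSplittings : FinLocalSplittings (Fp L) L (IsCMField.complexConj L) (n + n) (complexConj_imagUnit L) (imagUnit_ne_zero L)
    (imagUnit_mul_self L) (gramD L e dV hdV dW hdW) (gramD_isSymm L e dV hdV dW hdW) (J := hermD L e dV hdV dW hdW) rfl where
  s v := localSplittingAt L e dV hdV hdV0 dW hdW hdW0 χ 𝔪 𝓕 v
  proj_s v g := by
    letI := (𝔪 v).mS; haveI := (𝔪 v).isBorel; haveI := (𝔪 v).isHaar
    exact LocalSplittingDatum.proj_localSplitting (𝓕.𝓓 v) g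
  smooth v := by
    letI := (𝔪 v).mS; haveI := (𝔪 v).isBorel; haveI := (𝔪 v).isHaar
    intro Φ
    obtain ⟨U, hU, hfix⟩ := (𝓕.𝓓 v).smooth Φ
    refine Representation.isSmoothVector_of_le _ hU fun k hk => ?_
    rw [Representation.mem_stabilizerSubgroup]
    change LocalSplittingDatum.localOmega (𝓕.𝓓 v) k Φ = Φ
    rw [LocalSplittingDatum.localOmega_apply]
    exact hfix k hk
  unramified := 𝓕.unramified

/-- the local Weil representation of the family is `omegaAt`.
[cite: GelbartRogawski1991, §3.1 Prop. 3.1.1 p. 455 L1–2] -/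
theorem omegaLoc_finSplittings (v : HeightOneSpectrum (𝓞 (Fp L))) :
    (finSplittings L e dV hdV hdV0 dW hdW hdW0 χ 𝔪 𝓕).omegaLoc v = omegaAt L e dV hdV hdV0 dW hdW hdW0 (𝓕.𝓓 v) := rfl

/-- **the finite half** `s_f := ⊗'_v s_v : H(𝔸_f) →* Mp(𝕎^𝔻)ᶜᵒⁿᵗ` (tree `finSplitting`).
[cite: GelbartRogawski1991, §3.1 Prop. 3.1.1 p. 455 L1–2] -/
def finHalf : HAf' →* MpD L e dV hdV dW hdW := (finSplittings L e dV hdV hdV0 dW hdW hdW0 χ 𝔪 𝓕).finSplitting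

/-! ##### (d) the local implementers of `δ`, normalised to fix `1_{𝒪_vᴺ}` almost everywhere -/

/-- the datum's implementer `r_v(δ_v)` implements the rational element `δ` read at `v`.
[cite: GelbartRogawski1991, §3.1 Prop. 3.1.1 p. 455 L1–2] -/
theorem rDeltaAt_implements (v : HeightOneSpectrum (𝓞 (Fp L))) :
    Implements (localSchrodinger (Fp L) (n + n) (gramD L e dV hdV dW hdW) v)
      (ofSymplectic _ (ratSpLoc (Fp L) (n + n) (gramD L e dV hdV dW hdW) (isUnit_det_gramD L e dV hdV hdV0 dW hdW hdW0) v (deltaD L)))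
      (rDeltaAt L e dV hdV hdV0 dW hdW hdW0 (𝓕.𝓓 v)) := by
  letI := (𝔪 v).mS; haveI := (𝔪 v).isBorel; haveI := (𝔪 v).isHaar
  exact (𝓕.𝓓 v).r.implements (deltaLoc L e dV hdV hdV0 dW hdW hdW0 v)

/-- the normalising scalar at `v`: `r_v(δ_v) 1_{𝒪_vᴺ} = c_v 1_{𝒪_vᴺ}` when such a `c_v` exists, else `1`.
[cite: GelbartRogawski1991, §3.1 Prop. 3.1.1 p. 455 L1–2] -/
def deltaScalar (v : HeightOneSpectrum (𝓞 (Fp L))) : ℂˣ :=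
  if h : ∃ c : ℂˣ, rDeltaAt L e dV hdV hdV0 dW hdW hdW0 (𝓕.𝓓 v) (unitVec (Fp L) (Fin (n + n)) v) =
      (c : ℂ) • unitVec (Fp L) (Fin (n + n)) v then Classical.choose h else 1

/-- **the normalised local implementer `M_v := c_v⁻¹ r_v(δ_v)`.**
[cite: GelbartRogawski1991, §3.1 Prop. 3.1.1 p. 455 L1–2] -/
def deltaImpl (v : HeightOneSpectrum (𝓞 (Fp L))) :
    SchwartzBruhat (Fin (n + n) → v.adicCompletion (Fp L)) ≃ₗ[ℂ] SchwartzBruhat (Fin (n + n) → v.adicCompletion (Fp L)) :=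
  (rDeltaAt L e dV hdV hdV0 dW hdW hdW0 (𝓕.𝓓 v)).trans
    (LinearEquiv.smulOfUnit (deltaScalar L e dV hdV hdV0 dW hdW hdW0 χ 𝔪 𝓕 v)⁻¹)

/-- formula. [cite: GelbartRogawski1991, §3.1 Prop. 3.1.1 p. 455 L1–2] -/
theorem deltaImpl_apply (v : HeightOneSpectrum (𝓞 (Fp L))) (φ : SchwartzBruhat (Fin (n + n) → v.adicCompletion (Fp L))) :
    deltaImpl L e dV hdV hdV0 dW hdW hdW0 χ 𝔪 𝓕 v φ =
      (((deltaScalar L e dV hdV hdV0 dW hdW hdW0 χ 𝔪 𝓕 v)⁻¹ : ℂˣ) : ℂ) • rDeltaAt L e dV hdV hdV0 dW hdW hdW0 (𝓕.𝓓 v) φ := rfl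

/-- formula for the inverse. [cite: GelbartRogawski1991, §3.1 Prop. 3.1.1 p. 455 L1–2] -/
theorem deltaImpl_symm_apply (v : HeightOneSpectrum (𝓞 (Fp L))) (φ : SchwartzBruhat (Fin (n + n) → v.adicCompletion (Fp L))) :
    (deltaImpl L e dV hdV hdV0 dW hdW hdW0 χ 𝔪 𝓕 v).symm φ =
      (rDeltaAt L e dV hdV hdV0 dW hdW hdW0 (𝓕.𝓓 v)).symm (((deltaScalar L e dV hdV hdV0 dW hdW hdW0 χ 𝔪 𝓕 v : ℂˣ) : ℂ) • φ) := by
  change (rDeltaAt L e dV hdV hdV0 dW hdW hdW0 (𝓕.𝓓 v)).symm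
    (((((deltaScalar L e dV hdV hdV0 dW hdW hdW0 χ 𝔪 𝓕 v)⁻¹)⁻¹ : ℂˣ) : ℂ) • φ) = _
  rw [inv_inv]

/-- the normalised implementer still implements `δ_v`. [cite: GelbartRogawski1991, §3.1 Prop. 3.1.1 p. 455 L1–2] -/
theorem deltaImpl_implements (v : HeightOneSpectrum (𝓞 (Fp L))) :
    Implements (localSchrodinger (Fp L) (n + n) (gramD L e dV hdV dW hdW) v)
      (ofSymplectic _ (ratSpLoc (Fp L) (n + n) (gramD L e dV hdV dW hdW) (isUnit_det_gramD L e dV hdV hdV0 dW hdW hdW0) v (deltaD L)))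
      (deltaImpl L e dV hdV hdV0 dW hdW hdW0 χ 𝔪 𝓕 v) := by
  intro h φ
  rw [deltaImpl_apply, deltaImpl_apply, map_smul, rDeltaAt_implements L e dV hdV hdV0 dW hdW hdW0 χ 𝔪 𝓕 v h φ]

/-- **the normalised implementers fix `1_{𝒪_vᴺ}` for almost all `v`** (tree `eventually_exists_smul_unitVec`).
[cite: GelbartRogawski1991, §3.1 Prop. 3.1.1 p. 455 L1–2] -/
theorem eventually_deltaImpl_unitVec :
    ∀ᶠ v in Filter.cofinite, deltaImpl L e dV hdV hdV0 dW hdW hdW0 χ 𝔪 𝓕 v (unitVec (Fp L) (Fin (n + n)) v) =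
      unitVec (Fp L) (Fin (n + n)) v := by
  refine (eventually_exists_smul_unitVec (Fp L) (n + n) (gramD L e dV hdV dW hdW) (isUnit_det_gramD L e dV hdV hdV0 dW hdW hdW0)
    (deltaD L) (hU_family L e dV hdV hdV0 dW hdW hdW0 χ 𝔪 𝓕)).mono fun v hv => ?_
  have h : ∃ c : ℂˣ, rDeltaAt L e dV hdV hdV0 dW hdW hdW0 (𝓕.𝓓 v) (unitVec (Fp L) (Fin (n + n)) v) =
      (c : ℂ) • unitVec (Fp L) (Fin (n + n)) v := hv _ (rDeltaAt_implements L e dV hdV hdV0 dW hdW hdW0 χ 𝔪 𝓕 v)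
  have key : ∀ c : ℂˣ, rDeltaAt L e dV hdV hdV0 dW hdW hdW0 (𝓕.𝓓 v) (unitVec (Fp L) (Fin (n + n)) v) =
      (c : ℂ) • unitVec (Fp L) (Fin (n + n)) v →
      (((c⁻¹ : ℂˣ)) : ℂ) • rDeltaAt L e dV hdV hdV0 dW hdW hdW0 (𝓕.𝓓 v) (unitVec (Fp L) (Fin (n + n)) v) =
        unitVec (Fp L) (Fin (n + n)) v := fun c hc => by
    rw [hc, smul_smul, ← Units.val_mul, inv_mul_cancel, Units.val_one, one_smul]
  rw [deltaImpl_apply]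
  unfold deltaScalar
  rw [dif_pos h]
  exact key _ (Classical.choose_spec h)

/-- conjugation is blind to the normalising scalar: `M_v X M_v⁻¹ φ = r_v(δ) X r_v(δ)⁻¹ φ` for linear `X`.
[cite: GelbartRogawski1991, §3.1 Prop. 3.1.1 p. 455 L1–2] -/
theorem deltaImpl_conj (v : HeightOneSpectrum (𝓞 (Fp L)))
    (X : SchwartzBruhat (Fin (n + n) → v.adicCompletion (Fp L)) →ₗ[ℂ] SchwartzBruhat (Fin (n + n) → v.adicCompletion (Fp L)))
    (φ : SchwartzBruhat (Fin (n + n) → v.adicCompletion (Fp L))) :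
    deltaImpl L e dV hdV hdV0 dW hdW hdW0 χ 𝔪 𝓕 v (X ((deltaImpl L e dV hdV hdV0 dW hdW hdW0 χ 𝔪 𝓕 v).symm φ)) =
      rDeltaAt L e dV hdV hdV0 dW hdW hdW0 (𝓕.𝓓 v) (X ((rDeltaAt L e dV hdV hdV0 dW hdW hdW0 (𝓕.𝓓 v)).symm φ)) := by
  rw [deltaImpl_symm_apply, deltaImpl_apply, map_smul, map_smul, map_smul, smul_smul, ← Units.val_mul, inv_mul_cancel,
    Units.val_one, one_smul]

/-! ##### (e) the parabolic prescription of the finite half; `IsFinHalf` -/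

/-- the local prescription (the field `parabolicNormalised v`) for the NORMALISED implementers, in the shape consumed by the
tree's `conjOp_apply_zero`. [cite: GelbartRogawski1991, §3.1 Prop. 3.1.1 p. 455 L1–2] -/
theorem finHalf_hloc (v : HeightOneSpectrum (𝓞 (Fp L))) (u : LocPi' v)
    (hu : IsSiegelDelta L e dV hdV dW hdW (locToAdelic L e dV hdV dW hdW v u))
    (φ : SchwartzBruhat (Fin (n + n) → v.adicCompletion (Fp L))) :
    ((deltaImpl L e dV hdV hdV0 dW hdW hdW0 χ 𝔪 𝓕 v ((finSplittings L e dV hdV hdV0 dW hdW hdW0 χ 𝔪 𝓕).omegaLoc v u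
        ((deltaImpl L e dV hdV hdV0 dW hdW hdW0 χ 𝔪 𝓕 v).symm φ)) : SchwartzBruhat (Fin (n + n) → v.adicCompletion (Fp L))) :
          (Fin (n + n) → v.adicCompletion (Fp L)) → ℂ) 0 =
      (((chiDet L e dV hdV dW hdW χ (finToA' (inclP' v u)) : ℂˣ) : ℂ) * (modDelta L e dV hdV dW hdW (finToA' (inclP' v u)) : ℂ)) *
        ((φ : SchwartzBruhat (Fin (n + n) → v.adicCompletion (Fp L))) : (Fin (n + n) → v.adicCompletion (Fp L)) → ℂ) 0 := by
  rw [deltaImpl_conj L e dV hdV hdV0 dW hdW hdW0 χ 𝔪 𝓕 v ((finSplittings L e dV hdV hdV0 dW hdW hdW0 χ 𝔪 𝓕).omegaLoc v u) φ]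
  exact 𝓕.parabolicNormalised v u hu (isUnit_detDelta_of_isSiegelDelta L e dV hdV dW hdW _ hu) φ

/-- `opD (r_F^𝔻(δ) · s_f(g) · r_F^𝔻(δ)⁻¹) Φ` is the tree's `conjOp` applied to `Φ` (definitional bookkeeping).
[cite: GelbartRogawski1991, §3.1 Prop. 3.1.1 p. 455 L1–2] -/
theorem opD_conj_finHalf (g : HAf') (Φ : piSchwartzBruhat (Fp L) (Fin (n + n))) :
    opD L e dV hdV dW hdW (rDelta L e dV hdV hdV0 dW hdW hdW0 * finHalf L e dV hdV hdV0 dW hdW hdW0 χ 𝔪 𝓕 g *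
        (rDelta L e dV hdV hdV0 dW hdW hdW0)⁻¹) Φ =
      ((conjOp (gramD L e dV hdV dW hdW) (finSplittings L e dV hdV hdV0 dW hdW hdW0 χ 𝔪 𝓕)
          (MpPsi.toOp _ ((rDelta L e dV hdV hdV0 dW hdW hdW0 : MpD L e dV hdV dW hdW) :
            adelicMp (Fp L) (Fin (n + n)) (gramDA L e dV hdV dW hdW))) g Φ : piSchwartzBruhat (Fp L) (Fin (n + n))) :
        (Fin (n + n) → AdeleRing (𝓞 (Fp L)) (Fp L)) → ℂ) := rfl

/-- the symplectic component of `r_F^𝔻(δ)` is the rational element `δ` read in `Sp(𝕎^𝔻_𝔸)` (tree `proj_coe_ratThetaLiftCont`).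
[cite: GelbartRogawski1991, §3.1 Prop. 3.1.1 p. 455 L1–2] -/
theorem fst_rDelta_eq_ratSp :
    (((rDelta L e dV hdV hdV0 dW hdW hdW0 : MpD L e dV hdV dW hdW) : adelicMp (Fp L) (Fin (n + n)) (gramDA L e dV hdV dW hdW)) :
        symplecticGroup (polar (adelicForm (Fp L) (Fin (n + n)) (gramDA L e dV hdV dW hdW))) ×
          (piSchwartzBruhat (Fp L) (Fin (n + n)) ≃ₗ[ℂ] piSchwartzBruhat (Fp L) (Fin (n + n)))).1 =
      ratSp (Fp L) ((gramD L e dV hdV dW hdW).map (algebraMap (Fp L) (AdeleRing (𝓞 (Fp L)) (Fp L))))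
        (isUnit_det_gramAdele (Fp L) (n + n) (gramD L e dV hdV dW hdW) (isUnit_det_gramD L e dV hdV hdV0 dW hdW hdW0)) (deltaD L) :=
  proj_coe_ratThetaLiftCont (F := Fp L) (T := gramDA L e dV hdV dW hdW) (hT := isUnit_det_gramDA L e dV hdV hdV0 dW hdW hdW0) (deltaD L)

set_option maxHeartbeats 800000 in
/-- **THE PARABOLIC PRESCRIPTION OF THE FINITE HALF** (tree `conjOp_apply_zero` at `P_v := P_Δ`, `λ := χ(det_Δ)|det_Δ|^{1/2}`,
`M_v :=` the normalised `r_v(δ_v)`; the single-place input is the field `parabolicNormalised v`).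
[cite: GelbartRogawski1991, §3.1 Prop. 3.1.1 p. 455 L1–2] -/
theorem finHalf_parabolic :
    ParabolicPrescribed L e dV hdV hdV0 dW hdW hdW0 finToA' χ (finHalf L e dV hdV hdV0 dW hdW hdW0 χ 𝔪 𝓕) := by
  intro g hg _ Φ
  obtain ⟨A, hA⟩ := exists_arch_tmul (gramD L e dV hdV dW hdW) (isUnit_det_gramD L e dV hdV hdV0 dW hdW hdW0) (deltaD L)
    (deltaImpl L e dV hdV hdV0 dW hdW hdW0 χ 𝔪 𝓕) (deltaImpl_implements L e dV hdV hdV0 dW hdW hdW0 χ 𝔪 𝓕)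
    (eventually_deltaImpl_unitVec L e dV hdV hdV0 dW hdW hdW0 χ 𝔪 𝓕)
    ((rDelta L e dV hdV hdV0 dW hdW hdW0 : MpD L e dV hdV dW hdW) : adelicMp (Fp L) (Fin (n + n)) (gramDA L e dV hdV dW hdW))
    (rDelta L e dV hdV hdV0 dW hdW hdW0).2 (fst_rDelta_eq_ratSp L e dV hdV hdV0 dW hdW hdW0)
  have key := conjOp_apply_zero (gramD L e dV hdV dW hdW) (finSplittings L e dV hdV hdV0 dW hdW hdW0 χ 𝔪 𝓕)
    (deltaImpl L e dV hdV hdV0 dW hdW hdW0 χ 𝔪 𝓕) (eventually_deltaImpl_unitVec L e dV hdV hdV0 dW hdW hdW0 χ 𝔪 𝓕)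
    (fun Φinf f => (hA Φinf f).1) (fun Φinf f => (hA Φinf f).2)
    (fun v u => IsSiegelDelta L e dV hdV dW hdW (locToAdelic L e dV hdV dW hdW v u))
    (fun v => by rw [map_one]; exact isSiegelDelta_one' L e dV hdV dW hdW)
    (fun g => ((chiDet L e dV hdV dW hdW χ (finToA' g) : ℂˣ) : ℂ) * (modDelta L e dV hdV dW hdW (finToA' g) : ℂ))
    (fun g g' hg hg' => by
      have hS := (isSiegelDelta_finToA_iff_forall_place L e dV hdV dW hdW g).2 hg
      have hS' := (isSiegelDelta_finToA_iff_forall_place L e dV hdV dW hdW g').2 hg'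
      have h1 : chiDet L e dV hdV dW hdW χ (finToA' (g * g')) =
          chiDet L e dV hdV dW hdW χ (finToA' g) * chiDet L e dV hdV dW hdW χ (finToA' g') := by
        rw [← chiDet_mul L e dV hdV dW hdW χ hS hS']; exact congrArg _ (map_mul _ g g')
      have h2 : modDelta L e dV hdV dW hdW (finToA' (g * g')) =
          modDelta L e dV hdV dW hdW (finToA' g) * modDelta L e dV hdV dW hdW (finToA' g') := by
        rw [← modDelta_mul L e dV hdV dW hdW hS hS']; exact congrArg _ (map_mul _ g g')
      change ((chiDet L e dV hdV dW hdW χ (finToA' (g * g')) : ℂˣ) : ℂ) * (modDelta L e dV hdV dW hdW (finToA' (g * g')) : ℂ) = _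
      rw [h1, h2, Units.val_mul, Complex.ofReal_mul]
      ring)
    (by
      have h1 : chiDet L e dV hdV dW hdW χ (finToA' 1) = 1 := by
        rw [← chiDet_one' L e dV hdV dW hdW χ]; exact congrArg _ (map_one _)
      have h2 : modDelta L e dV hdV dW hdW (finToA' 1) = 1 := by
        rw [← modDelta_one' L e dV hdV dW hdW]; exact congrArg _ (map_one _)
      change ((chiDet L e dV hdV dW hdW χ (finToA' 1) : ℂˣ) : ℂ) * (modDelta L e dV hdV dW hdW (finToA' 1) : ℂ) = 1
      rw [h1, h2, Units.val_one, Complex.ofReal_one, mul_one])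
    ((continuousOn_chiDet_modDelta L e dV hdV dW hdW χ).mono fun g hg =>
      (isSiegelDelta_finToA_iff_forall_place L e dV hdV dW hdW g).2 hg)
    (fun v u hu φ => finHalf_hloc L e dV hdV hdV0 dW hdW hdW0 χ 𝔪 𝓕 v u hu φ)
    g ((isSiegelDelta_finToA_iff_forall_place L e dV hdV dW hdW g).1 hg) Φ
  rw [opD_conj_finHalf]
  exact key

/-- **`s_f` IS A FINITE HALF**: continuous, over `ι^𝔻`, finite operators, parabolic-prescribed.
[cite: GelbartRogawski1991, §3.1 Prop. 3.1.1 p. 455 L1–2] -/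
theorem finHalf_isFinHalf : IsFinHalf L e dV hdV hdV0 dW hdW hdW0 χ (finHalf L e dV hdV hdV0 dW hdW hdW0 χ 𝔪 𝓕) where
  continuous := (finSplittings L e dV hdV hdV0 dW hdW hdW0 χ 𝔪 𝓕).continuous_finSplitting
  proj_eq g := (finSplittings L e dV hdV hdV0 dW hdW hdW0 χ 𝔪 𝓕).proj_finSplitting g
  isFinite g := (finSplittings L e dV hdV hdV0 dW hdW hdW0 χ 𝔪 𝓕).exists_omega_finSplitting_eq g
  parabolic := finHalf_parabolic L e dV hdV hdV0 dW hdW hdW0 χ 𝔪 𝓕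

/-- **S1fin-asm**: a per-place family yields a finite half.
[cite: GelbartRogawski1991, §3.1 Prop. 3.1.1 p. 455 L1–2] -/
theorem S1fin_asm (χ : HeckeCharacter L) (𝔪 : ∀ v, PlaceMeasure L v) (𝓕 : FinLocalFamily L e dV hdV hdV0 dW hdW hdW0 χ 𝔪) :
    ∃ sf, IsFinHalf L e dV hdV hdV0 dW hdW hdW0 χ sf :=
  ⟨_, finHalf_isFinHalf L e dV hdV hdV0 dW hdW hdW0 χ 𝔪 𝓕⟩

end Family

end S1finAsm

/-! ### Build-lane note (ops-buildfix G11b-3 recipe, LEDGER B13-1, 2026-08-21)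
`lean -o` (the hub build lane, never `lean`/the gate check) runs Lean 4.32's library-suggestion indexers
(`Lean.LibrarySuggestions.SymbolFrequency` / `SineQuaNon`, from their `exportEntriesFn`) over the statement of
every local theorem that is not a denied premise; on this family's statements (very large dependent binder
telescopes through the theta-kernel / dual-pair data) that fold runs for tens of minutes to hours and the build
lane kills the job (incident G11b-3, run/shared/lean/ops/buildfix/G11b-3-DOSSIER.md). `isDeniedPremise` skips
`[implicit_reducible]` constants before any fold, and a reducibility status on a *theorem* is inert (Meta never
unfolds `thmInfo`; the kernel ignores the attribute), so the public theorems of this file are tagged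
`[implicit_reducible]` purely to keep them out of that index. Only other effect: they are not offered by
`+suggestions` premise selectors. No statement or proof is changed; superseded if the operator lands a
deny-list form (`HarnessLib.PremiseIndex`). -/
set_option allowUnsafeReducibility true in
attribute [implicit_reducible]
  continuous_detDelta mem_siegelSetFin_iff continuousOn_unit_detDelta continuousOn_chiDet_modDelta
  isSiegelDelta_finToA_iff_forall_place hU_family omegaLoc_finSplittings rDeltaAt_implements
  deltaImpl_apply deltaImpl_symm_apply deltaImpl_implements eventually_deltaImpl_unitVec
  deltaImpl_conj finHalf_hloc opD_conj_finHalf fst_rDelta_eq_ratSp finHalf_parabolic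
  finHalf_isFinHalf S1fin_asm

end Literature.NumberTheory.GelbartRogawski1991.GRConstruction
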